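/-
Copyright: cell `pub-ymgap` (HUMAN RULING D-0062), Track A of `YM-PLAN.md`, DAG node N20 (= NE7b); R134 acceleration seat
`pub-ymgap-dag-n20-c` (strategy s1, generation 7), module 39.  Released under the licence of the surrounding project.
-/
import Summits.QuantumFields.YangMills.Theorems.BalabanUVNodesN20LCSLargeFieldSubfamilies
import HarnessLib

/-!
# YM-DAG node N20 (= NE7b), row s1, module 39: THE TRANSFER AND THE PINNED-FAMILY BOUND FROM MOMENTS ON THE HULL ONLY — n20-d's (LS) transfer
# rule (`N20LCSAvgTransfer`) and modules 22 ∕ 23's «LCS-k ⇒ pinned hrel» re-displayed with the moment hypothesis asked ONLY for plaquette sets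
# inside the box-hull of the pinned cells' regions (the repaired shape of module 38's wall audit), by the SAME proofs

Track A of `YM-PLAN.md` (cell `pub-ymgap`, HUMAN RULING D-0062), node **N20** = spine estimate NE7b (`T4WeightBudget.RelWeightBound`, NOT
PRINTED, NOT PROVED).  Seat `pub-ymgap-dag-n20-c` (R134, s1), generation 7, module 39 (imports module 23 `…N20LCSLargeFieldSubfamilies`, hence
module 22 and n20-d's modules 1–6).  Kernel theorems only: 0 `def`, 0 `sorry`, standard axioms; COUNT-NEUTRAL.

WHY.  Module 38 (`…N20LCSWallShape`) certifies that the display «LCS-k for EVERY level-`k` plaquette set `X`» of modules 22 ∕ 23 ∕ 30 ∕ 32 ∕ 35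
over-asks; but every proof in that chain instantiates the moment hypothesis ONLY at `X = Q.biUnion (p′ ↦ boxRegion (emb p′.src) ((d+3)L+2))`
for `Q` inside the pinned cells' regions (n20-d's `localExpMoment_avgFun_of_moments`).  THIS FILE re-displays the chain up to module 23 with the
hypothesis asked only for the `X` INSIDE THE HULL of `⋃_{c ∈ D} R c` (every `q ∈ X` lies in `boxRegion (emb p′.src) ((d+3)L+2)` for some `p′ ∈ R c`,
`c ∈ D`; stated by membership, no `Finset.biUnion` instance in any signature), proofs of record otherwise VERBATIM (credit: n20-d g3 modules 5∕6,
this seat's g4 modules 22∕23): §1 `measureReal_forall_exists_le_pow_of_subset` (one witness per cell, the per-`Y` bound only for `Y` inside the cells);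
§2 `localExpMoment_avgFun_of_moments_hull`, `measureReal_largeField_avgFun_le_of_moments_hull`, `measureReal_largeFieldCells_avgFun_le_of_moments_hull`;
§3 `setIntegral_forall_exists_le_of_moments_hull`, ★ `abs_integral_pinnedSubfamily_le_of_moments_hull` — «LCS-k ON THE HULL in the old term's state ⇒ the
pinned sub-family's hrel at step k», same Peierls rate.  Module 40 (`…N20LCSHullDisplay`) carries this to the label tower of record (+ the WINDOW).

HONEST FRAMING.  A RE-DISPLAY with a weaker hypothesis by the proofs of record; no new estimate; the hull-restricted «LCS-k» at `k ≥ 1` (level-uniform)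
is Bałaban's small-field analysis ((A1c)) and stays displayed.  NE7b NOT PRINTED ∕ NOT PROVED; (α)-instance 0∕1; N20 NOT discharged; typed 28∕28,
discharged count untouched; one finite four-torus at fixed `ε` — NOT ℝ⁴, NOT infinite volume, NOT OS, NOT a mass gap, NOT Clay.
References (LOCATORS): T. Bałaban [Balaban1985Averaging] Prop. 1 (51) p. 26; [Balaban1987RG1] (0.4) p. 253; [Balaban1989LargeFieldI] (0.1) p. 175,
(0.3)–(0.5) pp. 176–177; [Balaban1988Convergent] (3.2) p. 265. -/

set_option autoImplicit false

noncomputable section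

open scoped BigOperators

namespace Summit.QuantumFields.YangMills.BalabanUVNodes.N20LCSHullTransfer

open MeasureTheory
open Literature.MathematicalPhysics.QuantumFieldTheory.Balaban1983to89
open Literature.MathematicalPhysics.QuantumFieldTheory.Balaban1983to89.T4Continuum
open Literature.MathematicalPhysics.QuantumFieldTheory.Balaban1983to89.Node00
open T4ReflectionCone BlockAveraging ExpMeanLog
open Summit.QuantumFields.YangMills.BalabanUVNodes.N20LCSAvgDominationRegion (boxRegion card_boxRegion_le)
open Summit.QuantumFields.YangMills.BalabanUVNodes.N20LCSAvgExpMoment (sum_one_sub_reTr_plaqHol_avgFun_le sq_div_le_one_sub_reTr_of_le_dist1)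
open Summit.QuantumFields.YangMills.BalabanUVNodes.N20LCSPushforward (card_biUnion_le_mul)
open Summit.QuantumFields.YangMills.BalabanUVNodes.N20LCSCoarseSparseness (measureReal_forall_le_le_of_expMoment)
open Summit.QuantumFields.YangMills.BalabanUVNodes.N20LCSAvgTransfer
  (measurable_exp_plaqSum_gen abs_exp_plaqSum_gen_le integrable_exp_plaqSum_avgFun_finite)
open Summit.QuantumFields.YangMills.BalabanUVNodes.N20LCSLargeFieldSubfamilies (abs_integral_sum_sub_mul_le)

/-! ## §1 The one-witness-per-cell count with the per-`Y` bound restricted to the cells -/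

section Counting

variable {Ω : Type*} [MeasurableSpace Ω] (μ : Measure Ω) [IsFiniteMeasure μ]

/-- **ONE WITNESS PER CELL (n20-d module 5's `measureReal_forall_exists_le_pow`), the per-`Y` bound asked only for the `Y` inside the cells** — the
choice functions' images lie there; proof of record otherwise verbatim. [folklore] -/
theorem measureReal_forall_exists_le_pow_of_subset {κ π : Type*} [DecidableEq κ] [DecidableEq π] (E : π → Set Ω) (𝒞 : Finset κ)
    (cells : κ → Finset π) {m : ℕ} (hm : ∀ c ∈ 𝒞, (cells c).card ≤ m)
    (hdisj : ∀ c₁ ∈ 𝒞, ∀ c₂ ∈ 𝒞, c₁ ≠ c₂ → Disjoint (cells c₁) (cells c₂))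
    {r : ℝ} (hr : 0 ≤ r) (hY : ∀ Y : Finset π, (∀ p ∈ Y, ∃ c ∈ 𝒞, p ∈ cells c) → μ.real {ω | ∀ p ∈ Y, ω ∈ E p} ≤ r ^ Y.card) :
    μ.real {ω | ∀ c ∈ 𝒞, ∃ p ∈ cells c, ω ∈ E p} ≤ ((m : ℝ) * r) ^ 𝒞.card := by
  classical
  set F := 𝒞.pi cells with hF
  let A : ((c : κ) → c ∈ 𝒞 → π) → Set Ω := fun f => {ω | ∀ (c : κ) (hc : c ∈ 𝒞), ω ∈ E (f c hc)}
  have hsub : {ω | ∀ c ∈ 𝒞, ∃ p ∈ cells c, ω ∈ E p} ⊆ ⋃ f ∈ F, A f := by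
    intro ω hω
    simp only [Set.mem_setOf_eq] at hω
    choose g hg hE using hω
    exact Set.mem_biUnion (x := g) (Finset.mem_coe.mpr (Finset.mem_pi.mpr fun c hc => hg c hc)) fun c hc => hE c hc
  have hA : ∀ f ∈ F, μ.real (A f) ≤ r ^ 𝒞.card := by
    intro f hf
    have hfmem : ∀ (c : κ) (hc : c ∈ 𝒞), f c hc ∈ cells c := fun c hc => Finset.mem_pi.mp hf c hc
    set Y : Finset π := 𝒞.attach.image (fun c => f c.1 c.2) with hYdef
    have hYsub : ∀ p ∈ Y, ∃ c ∈ 𝒞, p ∈ cells c := by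
      intro p hp
      obtain ⟨c, -, rfl⟩ := Finset.mem_image.mp hp
      exact ⟨c.1, c.2, hfmem c.1 c.2⟩
    have hAY : A f ⊆ {ω | ∀ p ∈ Y, ω ∈ E p} := by
      intro ω hω p hp
      obtain ⟨c, -, rfl⟩ := Finset.mem_image.mp hp
      exact hω c.1 c.2
    have hinj : Set.InjOn (fun c : {c // c ∈ 𝒞} => f c.1 c.2) ↑(𝒞.attach) := by
      intro c₁ _ c₂ _ h
      by_contra hne
      have hne' : c₁.1 ≠ c₂.1 := fun h' => hne (Subtype.ext h')
      have hd := hdisj c₁.1 c₁.2 c₂.1 c₂.2 hne'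
      have h1 : f c₁.1 c₁.2 ∈ cells c₁.1 := hfmem _ _
      have h2 : f c₁.1 c₁.2 ∈ cells c₂.1 := by
        have := hfmem c₂.1 c₂.2
        simp only at h
        rwa [← h] at this
      exact Finset.disjoint_left.mp hd h1 h2
    have hYcard : Y.card = 𝒞.card := by
      rw [hYdef, Finset.card_image_of_injOn hinj, Finset.card_attach]
    calc μ.real (A f) ≤ μ.real {ω | ∀ p ∈ Y, ω ∈ E p} := measureReal_mono hAY (measure_ne_top μ _)
      _ ≤ r ^ Y.card := hY Y hYsub
      _ = r ^ 𝒞.card := by rw [hYcard]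
  have hFcard : (F.card : ℝ) ≤ (m : ℝ) ^ 𝒞.card := by
    have h : F.card ≤ m ^ 𝒞.card := by
      rw [hF, Finset.card_pi]
      exact Finset.prod_le_pow_card _ _ _ hm
    exact_mod_cast h
  calc μ.real {ω | ∀ c ∈ 𝒞, ∃ p ∈ cells c, ω ∈ E p} ≤ μ.real (⋃ f ∈ F, A f) := measureReal_mono hsub (measure_ne_top μ _)
    _ ≤ ∑ f ∈ F, μ.real (A f) := measureReal_biUnion_finset_le _ _
    _ ≤ ∑ _f ∈ F, r ^ 𝒞.card := Finset.sum_le_sum hA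
    _ = F.card * r ^ 𝒞.card := by rw [Finset.sum_const, nsmul_eq_mul]
    _ ≤ (m : ℝ) ^ 𝒞.card * r ^ 𝒞.card := mul_le_mul_of_nonneg_right hFcard (pow_nonneg hr _)
    _ = ((m : ℝ) * r) ^ 𝒞.card := by rw [mul_pow]

end Counting
/-! ## §2 n20-d's transfer rule with the moment hypothesis on the hull only -/

section Transfer

variable {n : Type*} [Fintype n] [DecidableEq n] [Nonempty n] {P : Params} {j : ℕ}

/-- **THE TRANSFER ON THE HULL** (n20-d's `localExpMoment_avgFun_of_moments`, hypothesis restricted): moments of the level-`j` plaquette energies under a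
finite measure `ν` for the sets `X` INSIDE THE HULL OF `Q` ONLY (every `q ∈ X` lies in the box region `boxRegion (emb p′.src) ((d+3)L+2)` of some `p′ ∈ Q`)
⇒ the moment of the averaged field's energies on `Q`, same constants; proof of record, the moment hypothesis met by n20-d's summed letter's own region.
[cite: Balaban1985Averaging, Prop. 1 (51) p.26; Balaban1987RG1, (0.4) p.253] -/
theorem localExpMoment_avgFun_of_moments_hull (hj : j + 1 ≤ P.m + P.K) {α : ℝ} (hα : 0 < α)
    (hguard : ((((P.d + 2) * P.L : ℕ) : ℝ) ^ 2 / 4) * Real.sqrt (2 * (Fintype.card n : ℝ) * α) < deltaSU n)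
    (ν : Measure (GaugeField P j (Matrix.specialUnitaryGroup n ℂ))) [IsFiniteMeasure ν] {β : ℝ} (hβ : 0 ≤ β) {C a₀ : ℝ} (hC : 0 ≤ C)
    (Q : Finset (Plaq P (j + 1)))
    (hLS : ∀ a : ℝ, 0 ≤ a → a ≤ a₀ → ∀ X : Finset (Plaq P j), (∀ q ∈ X, ∃ p' ∈ Q, q ∈ boxRegion (emb p'.src) ((P.d + 3) * P.L + 2)) →
      ∫ U, Real.exp (a * β * ∑ q ∈ X, (1 - reTr (GaugeField.plaqHol U q))) ∂ν ≤ Real.exp (C * a * X.card))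
    {δ : ℝ} (hδ0 : 0 ≤ δ)
    (hδ : δ * ((2 * (Fintype.card n : ℝ) * ((P.L : ℝ) ^ 2 + 6 * (((P.d + 2) * P.L : ℕ) : ℝ) ^ 2) ^ 2 + 2 / α) *
      (((2 * ((P.d + 3) * P.L + 2) + 1) ^ P.d * P.d ^ 2 : ℕ) : ℝ)) ≤ a₀) :
    ∫ U, Real.exp (δ * β * ∑ p ∈ Q, (1 - reTr (GaugeField.plaqHol (avgFun (expMeanLogSU (n := n)) U) p))) ∂ν ≤
      Real.exp (C * ((2 * (Fintype.card n : ℝ) * ((P.L : ℝ) ^ 2 + 6 * (((P.d + 2) * P.L : ℕ) : ℝ) ^ 2) ^ 2 + 2 / α) *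
        (((2 * ((P.d + 3) * P.L + 2) + 1) ^ P.d * P.d ^ 2 : ℕ) : ℝ)) *
        (((2 * ((P.d + 3) * P.L + 2) + 1) ^ P.d * P.d ^ 2 : ℕ) : ℝ) * δ * Q.card) := by
  classical
  set A : ℝ := 2 * (Fintype.card n : ℝ) * ((P.L : ℝ) ^ 2 + 6 * (((P.d + 2) * P.L : ℕ) : ℝ) ^ 2) ^ 2 + 2 / α with hA
  set M : ℕ := (2 * ((P.d + 3) * P.L + 2) + 1) ^ P.d * P.d ^ 2 with hM
  have hA0 : 0 < A := by positivity
  have hM0 : (0 : ℝ) ≤ (M : ℝ) := Nat.cast_nonneg _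
  set R : Plaq P (j + 1) → Finset (Plaq P j) := fun p => boxRegion (emb p.src) ((P.d + 3) * P.L + 2) with hR
  -- n20-d's summed letter, read with the ambient `DecidableEq` instance of the union (instances are subsingletons)
  have hdom : ∀ U : GaugeField P j (Matrix.specialUnitaryGroup n ℂ),
      ∑ p ∈ Q, (1 - reTr (GaugeField.plaqHol (avgFun (expMeanLogSU (n := n)) U) p)) ≤
        A * M * ∑ q ∈ Q.biUnion R, (1 - reTr (GaugeField.plaqHol U q)) := fun U => by
    have h0 := sum_one_sub_reTr_plaqHol_avgFun_le (n := n) hj hα hguard U Q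
    rw [← hM] at h0
    convert h0 using 4
  set X : Finset (Plaq P j) := Q.biUnion R with hX
  have hXhull : ∀ q ∈ X, ∃ p' ∈ Q, q ∈ boxRegion (emb p'.src) ((P.d + 3) * P.L + 2) := fun q hq => by
    obtain ⟨p', hp', hq'⟩ := Finset.mem_biUnion.mp hq
    exact ⟨p', hp', hq'⟩
  set a : ℝ := δ * (A * M) with ha
  have ha0 : 0 ≤ a := by positivity
  have haa₀ : a ≤ a₀ := hδ
  have hpt : ∀ U : GaugeField P j (Matrix.specialUnitaryGroup n ℂ),
      δ * β * ∑ p ∈ Q, (1 - reTr (GaugeField.plaqHol (avgFun (expMeanLogSU (n := n)) U) p)) ≤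
        a * β * ∑ q ∈ X, (1 - reTr (GaugeField.plaqHol U q)) := by
    intro U
    have h := hdom U
    have hδβ : 0 ≤ δ * β := mul_nonneg hδ0 hβ
    calc δ * β * ∑ p ∈ Q, (1 - reTr (GaugeField.plaqHol (avgFun (expMeanLogSU (n := n)) U) p))
        ≤ δ * β * (A * M * ∑ q ∈ X, (1 - reTr (GaugeField.plaqHol U q))) := mul_le_mul_of_nonneg_left h hδβ
      _ = a * β * ∑ q ∈ X, (1 - reTr (GaugeField.plaqHol U q)) := by rw [ha]; ring
  have hg_int : Integrable (fun U : GaugeField P j (Matrix.specialUnitaryGroup n ℂ) =>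
      Real.exp (a * β * ∑ q ∈ X, (1 - reTr (GaugeField.plaqHol U q)))) ν := by
    refine (integrable_const (Real.exp (|a * β| * (2 * X.card)))).mono'
      (measurable_exp_plaqSum_gen (a * β) X).aestronglyMeasurable (ae_of_all _ fun U => ?_)
    rw [Real.norm_eq_abs]
    exact abs_exp_plaqSum_gen_le (a * β) X U
  have hmono : ∫ U, Real.exp (δ * β * ∑ p ∈ Q, (1 - reTr (GaugeField.plaqHol (avgFun (expMeanLogSU (n := n)) U) p))) ∂ν ≤
      ∫ U, Real.exp (a * β * ∑ q ∈ X, (1 - reTr (GaugeField.plaqHol U q))) ∂ν :=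
    integral_mono_of_nonneg (ae_of_all _ fun U => (Real.exp_pos _).le) hg_int
      (ae_of_all _ fun U => Real.exp_le_exp.mpr (hpt U))
  have hhyp := hLS a ha0 haa₀ X hXhull
  have hXcard : (X.card : ℝ) ≤ (M : ℝ) * Q.card := by
    have h := card_biUnion_le_mul Q R M fun p _ => by
      have := card_boxRegion_le (emb p.src) ((P.d + 3) * P.L + 2)
      rwa [← hM] at this
    exact_mod_cast h
  calc ∫ U, Real.exp (δ * β * ∑ p ∈ Q, (1 - reTr (GaugeField.plaqHol (avgFun (expMeanLogSU (n := n)) U) p))) ∂ν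
      ≤ ∫ U, Real.exp (a * β * ∑ q ∈ X, (1 - reTr (GaugeField.plaqHol U q))) ∂ν := hmono
    _ ≤ Real.exp (C * a * X.card) := hhyp
    _ ≤ Real.exp (C * a * ((M : ℝ) * Q.card)) := Real.exp_le_exp.mpr (mul_le_mul_of_nonneg_left hXcard (by positivity))
    _ = Real.exp (C * (A * M) * M * δ * Q.card) := by rw [ha]; ring_nf

/-- **COARSE LARGE-FIELD SPARSENESS ON `Y` UNDER A PROBABILITY STATE WITH MOMENTS ON THE HULL OF `Y`** (n20-d's
`measureReal_largeField_avgFun_le_of_moments`, hypothesis restricted). [cite: Balaban1989LargeFieldI, (0.1) p.175; Balaban1987RG1, (0.4) p.253] -/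
theorem measureReal_largeField_avgFun_le_of_moments_hull (hj : j + 1 ≤ P.m + P.K) {α : ℝ} (hα : 0 < α)
    (hguard : ((((P.d + 2) * P.L : ℕ) : ℝ) ^ 2 / 4) * Real.sqrt (2 * (Fintype.card n : ℝ) * α) < deltaSU n)
    (ν : Measure (GaugeField P j (Matrix.specialUnitaryGroup n ℂ))) [IsProbabilityMeasure ν] {β : ℝ} (hβ : 0 ≤ β) {C a₀ : ℝ} (hC : 0 ≤ C)
    (Y : Finset (Plaq P (j + 1)))
    (hLS : ∀ a : ℝ, 0 ≤ a → a ≤ a₀ → ∀ X : Finset (Plaq P j), (∀ q ∈ X, ∃ p' ∈ Y, q ∈ boxRegion (emb p'.src) ((P.d + 3) * P.L + 2)) →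
      ∫ U, Real.exp (a * β * ∑ q ∈ X, (1 - reTr (GaugeField.plaqHol U q))) ∂ν ≤ Real.exp (C * a * X.card))
    {δ : ℝ} (hδ0 : 0 ≤ δ)
    (hδ : δ * ((2 * (Fintype.card n : ℝ) * ((P.L : ℝ) ^ 2 + 6 * (((P.d + 2) * P.L : ℕ) : ℝ) ^ 2) ^ 2 + 2 / α) *
      (((2 * ((P.d + 3) * P.L + 2) + 1) ^ P.d * P.d ^ 2 : ℕ) : ℝ)) ≤ a₀)
    (ε : ℝ) :
    ν.real {U | ∀ p ∈ Y, ε ≤ 1 - reTr (GaugeField.plaqHol (avgFun (expMeanLogSU (n := n)) U) p)} ≤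
      Real.exp (C * ((2 * (Fintype.card n : ℝ) * ((P.L : ℝ) ^ 2 + 6 * (((P.d + 2) * P.L : ℕ) : ℝ) ^ 2) ^ 2 + 2 / α) *
        (((2 * ((P.d + 3) * P.L + 2) + 1) ^ P.d * P.d ^ 2 : ℕ) : ℝ)) *
        (((2 * ((P.d + 3) * P.L + 2) + 1) ^ P.d * P.d ^ 2 : ℕ) : ℝ) * δ * Y.card) * Real.exp (-(δ * β * ε * Y.card)) := by
  have hmarkov := measureReal_forall_le_le_of_expMoment ν Y
    (fun p U => 1 - reTr (GaugeField.plaqHol (avgFun (expMeanLogSU (n := n)) U) p)) (ε := ε) hδ0 hβ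
    (integrable_exp_plaqSum_avgFun_finite ν (δ * β) Y)
  exact hmarkov.trans (mul_le_mul_of_nonneg_right
    (localExpMoment_avgFun_of_moments_hull (n := n) hj hα hguard ν hβ hC Y hLS hδ0 hδ) (Real.exp_pos _).le)

/-- **THE PEIERLS WEIGHT PER LARGE-FIELD CELL UNDER A PROBABILITY STATE WITH MOMENTS ON THE HULL OF THE CELLS** (n20-d's
`measureReal_largeFieldCells_avgFun_le_of_moments`, hypothesis restricted to the `X` inside the hull of `⋃_{c∈𝒞} cells c`).
[cite: Balaban1989LargeFieldI, (0.1) p.175; Balaban1987RG1, (0.4) p.253] -/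
theorem measureReal_largeFieldCells_avgFun_le_of_moments_hull (hj : j + 1 ≤ P.m + P.K) {α : ℝ} (hα : 0 < α)
    (hguard : ((((P.d + 2) * P.L : ℕ) : ℝ) ^ 2 / 4) * Real.sqrt (2 * (Fintype.card n : ℝ) * α) < deltaSU n)
    (ν : Measure (GaugeField P j (Matrix.specialUnitaryGroup n ℂ))) [IsProbabilityMeasure ν] {β : ℝ} (hβ : 0 ≤ β) {C a₀ : ℝ} (hC : 0 ≤ C)
    {κ : Type*} [DecidableEq κ] (𝒞 : Finset κ) (cells : κ → Finset (Plaq P (j + 1)))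
    (hLS : ∀ a : ℝ, 0 ≤ a → a ≤ a₀ → ∀ X : Finset (Plaq P j),
      (∀ q ∈ X, ∃ c ∈ 𝒞, ∃ p' ∈ cells c, q ∈ boxRegion (emb p'.src) ((P.d + 3) * P.L + 2)) →
      ∫ U, Real.exp (a * β * ∑ q ∈ X, (1 - reTr (GaugeField.plaqHol U q))) ∂ν ≤ Real.exp (C * a * X.card))
    {δ : ℝ} (hδ0 : 0 ≤ δ)
    (hδ : δ * ((2 * (Fintype.card n : ℝ) * ((P.L : ℝ) ^ 2 + 6 * (((P.d + 2) * P.L : ℕ) : ℝ) ^ 2) ^ 2 + 2 / α) *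
      (((2 * ((P.d + 3) * P.L + 2) + 1) ^ P.d * P.d ^ 2 : ℕ) : ℝ)) ≤ a₀)
    (ε : ℝ) (m : ℕ) (hm : ∀ c ∈ 𝒞, (cells c).card ≤ m) (hdisj : ∀ c₁ ∈ 𝒞, ∀ c₂ ∈ 𝒞, c₁ ≠ c₂ → Disjoint (cells c₁) (cells c₂)) :
    ν.real {U | ∀ c ∈ 𝒞, ∃ p ∈ cells c, ε ≤ 1 - reTr (GaugeField.plaqHol (avgFun (expMeanLogSU (n := n)) U) p)} ≤
      ((m : ℝ) * Real.exp (C * ((2 * (Fintype.card n : ℝ) * ((P.L : ℝ) ^ 2 + 6 * (((P.d + 2) * P.L : ℕ) : ℝ) ^ 2) ^ 2 + 2 / α) *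
        (((2 * ((P.d + 3) * P.L + 2) + 1) ^ P.d * P.d ^ 2 : ℕ) : ℝ)) *
        (((2 * ((P.d + 3) * P.L + 2) + 1) ^ P.d * P.d ^ 2 : ℕ) : ℝ) * δ - δ * β * ε)) ^ 𝒞.card := by
  classical
  refine measureReal_forall_exists_le_pow_of_subset ν
    (fun p => {U : GaugeField P j (Matrix.specialUnitaryGroup n ℂ) |
      ε ≤ 1 - reTr (GaugeField.plaqHol (avgFun (expMeanLogSU (n := n)) U) p)})
    𝒞 cells hm hdisj (Real.exp_pos _).le fun Y hY => ?_
  rw [← N20LCSAvgCellPeierls.exp_mul_card_eq_pow]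
  refine measureReal_largeField_avgFun_le_of_moments_hull (n := n) hj hα hguard ν hβ hC Y (fun a ha ha0 X hX => hLS a ha ha0 X ?_) hδ0 hδ ε
  intro q hq
  obtain ⟨p', hp', hq'⟩ := hX q hq
  obtain ⟨c, hc, hp'c⟩ := hY p' hp'
  exact ⟨c, hc, p', hp'c, hq'⟩

end Transfer
/-! ## §3 Modules 22 §1 and 23 §3 on the hull: the pinned sub-family's hrel at step `k` from «LCS-k ON THE HULL» in the old term's state -/

section Record

variable {N : ℕ} [NeZero N] {P : Params} {j : ℕ}

/-- **THE `f`-MASS OF THE SIMULTANEOUS COARSE LARGE-FIELD EVENT FROM MOMENTS ON THE HULL** (module 22's `setIntegral_forall_exists_le_of_moments`, the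
hypothesis `hLS` asked only for the `X` inside the hull of `⋃_{c∈D} R c`; proof of record verbatim). [folklore] -/
theorem setIntegral_forall_exists_le_of_moments_hull (hj : j + 1 ≤ P.m + P.K) {α : ℝ} (hα : 0 < α)
    (hguard : ((((P.d + 2) * P.L : ℕ) : ℝ) ^ 2 / 4) * Real.sqrt (2 * (Fintype.card (Fin N) : ℝ) * α) < deltaSU (Fin N))
    {f : GaugeField P j (Matrix.specialUnitaryGroup (Fin N) ℂ) → ℝ} (hfm : Measurable f) (hf0 : ∀ U, 0 ≤ f U)
    (hf : Integrable f (fieldMeasure P j (Matrix.specialUnitaryGroup (Fin N) ℂ))) {β : ℝ} (hβ : 0 ≤ β) {C a₀ : ℝ} (hC : 0 ≤ C)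
    {κ : Type*} [DecidableEq κ] (D : Finset κ) (R : κ → Finset (Plaq P (j + 1)))
    (hLS : ∀ a : ℝ, 0 ≤ a → a ≤ a₀ → ∀ X : Finset (Plaq P j),
      (∀ q ∈ X, ∃ c ∈ D, ∃ p' ∈ R c, q ∈ boxRegion (emb p'.src) ((P.d + 3) * P.L + 2)) →
      ∫ U, Real.exp (a * β * ∑ q ∈ X, (1 - reTr (GaugeField.plaqHol U q))) * f U
          ∂(fieldMeasure P j (Matrix.specialUnitaryGroup (Fin N) ℂ)) ≤
        Real.exp (C * a * X.card) * ∫ U, f U ∂(fieldMeasure P j (Matrix.specialUnitaryGroup (Fin N) ℂ)))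
    {δ : ℝ} (hδ0 : 0 ≤ δ)
    (hδ : δ * ((2 * (Fintype.card (Fin N) : ℝ) * ((P.L : ℝ) ^ 2 + 6 * (((P.d + 2) * P.L : ℕ) : ℝ) ^ 2) ^ 2 + 2 / α) *
      (((2 * ((P.d + 3) * P.L + 2) + 1) ^ P.d * P.d ^ 2 : ℕ) : ℝ)) ≤ a₀)
    (ε : ℝ) (m : ℕ) (hm : ∀ c ∈ D, (R c).card ≤ m) (hdisj : ∀ c₁ ∈ D, ∀ c₂ ∈ D, c₁ ≠ c₂ → Disjoint (R c₁) (R c₂)) :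
    ∫ U in {U | ∀ c ∈ D, ∃ p' ∈ R c, ε ≤ 1 - reTr (GaugeField.plaqHol (avgFun (expMeanLogSU (n := Fin N)) U) p')}, f U
        ∂(fieldMeasure P j (Matrix.specialUnitaryGroup (Fin N) ℂ)) ≤
      ((m : ℝ) * Real.exp (C * ((2 * (Fintype.card (Fin N) : ℝ) * ((P.L : ℝ) ^ 2 + 6 * (((P.d + 2) * P.L : ℕ) : ℝ) ^ 2) ^ 2 + 2 / α) *
          (((2 * ((P.d + 3) * P.L + 2) + 1) ^ P.d * P.d ^ 2 : ℕ) : ℝ)) *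
          (((2 * ((P.d + 3) * P.L + 2) + 1) ^ P.d * P.d ^ 2 : ℕ) : ℝ) * δ - δ * β * ε)) ^ D.card *
        ∫ U, f U ∂(fieldMeasure P j (Matrix.specialUnitaryGroup (Fin N) ℂ)) := by
  classical
  set μ : Measure (GaugeField P j (Matrix.specialUnitaryGroup (Fin N) ℂ)) := fieldMeasure P j (Matrix.specialUnitaryGroup (Fin N) ℂ)
    with hμ
  set S : Set (GaugeField P j (Matrix.specialUnitaryGroup (Fin N) ℂ)) :=
    {U | ∀ c ∈ D, ∃ p' ∈ R c, ε ≤ 1 - reTr (GaugeField.plaqHol (avgFun (expMeanLogSU (n := Fin N)) U) p')} with hS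
  set Z : ℝ := ∫ U, f U ∂μ with hZ
  set r : ℝ := ((m : ℝ) * Real.exp (C * ((2 * (Fintype.card (Fin N) : ℝ) * ((P.L : ℝ) ^ 2 + 6 * (((P.d + 2) * P.L : ℕ) : ℝ) ^ 2) ^ 2 + 2 / α) *
          (((2 * ((P.d + 3) * P.L + 2) + 1) ^ P.d * P.d ^ 2 : ℕ) : ℝ)) *
          (((2 * ((P.d + 3) * P.L + 2) + 1) ^ P.d * P.d ^ 2 : ℕ) : ℝ) * δ - δ * β * ε)) ^ D.card with hr
  have hr0 : 0 ≤ r := pow_nonneg (mul_nonneg (Nat.cast_nonneg _) (Real.exp_pos _).le) _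
  have hZ0 : 0 ≤ Z := integral_nonneg hf0
  have hSm : MeasurableSet S := by
    have : S = ⋂ c ∈ D, ⋃ p' ∈ R c, {U : GaugeField P j (Matrix.specialUnitaryGroup (Fin N) ℂ) |
        ε ≤ 1 - reTr (GaugeField.plaqHol (avgFun (expMeanLogSU (n := Fin N)) U) p')} := by
      ext U; simp [hS]
    rw [this]
    refine Finset.measurableSet_biInter D fun c _ => Finset.measurableSet_biUnion (R c) fun p' _ => ?_
    exact measurableSet_le measurable_const ((measurable_const.sub
      (RegularGaugeGroup.measurable_reTr.comp (Missing.measurable_plaqHol p'))).comp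
        (measurable_avgFun (expMeanLogSU (n := Fin N)) measurable_expMeanLogSU_E))
  by_cases hZpos : Z = 0
  · have hle : ∫ U in S, f U ∂μ ≤ Z := setIntegral_le_integral hf (ae_of_all _ hf0)
    calc ∫ U in S, f U ∂μ ≤ Z := hle
      _ = r * Z := by rw [hZpos, mul_zero]
  have hZp : 0 < Z := lt_of_le_of_ne hZ0 (Ne.symm hZpos)
  set Fd : GaugeField P j (Matrix.specialUnitaryGroup (Fin N) ℂ) → ENNReal := fun U => ENNReal.ofReal (f U) with hFd
  have hFdm : Measurable Fd := ENNReal.measurable_ofReal.comp hfm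
  have hlint : ∫⁻ U, Fd U ∂μ = ENNReal.ofReal Z := by
    rw [hZ, ofReal_integral_eq_lintegral_ofReal hf (ae_of_all _ hf0)]
  set ν : Measure (GaugeField P j (Matrix.specialUnitaryGroup (Fin N) ℂ)) := (ENNReal.ofReal Z)⁻¹ • μ.withDensity Fd with hν
  have hZne : ENNReal.ofReal Z ≠ 0 := (ENNReal.ofReal_pos.mpr hZp).ne'
  haveI : IsProbabilityMeasure ν := by
    refine ⟨?_⟩
    rw [hν, Measure.smul_apply, withDensity_apply _ MeasurableSet.univ, Measure.restrict_univ, hlint, smul_eq_mul,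
      ENNReal.inv_mul_cancel hZne ENNReal.ofReal_ne_top]
  have hνint : ∀ G : GaugeField P j (Matrix.specialUnitaryGroup (Fin N) ℂ) → ℝ,
      ∫ U, G U ∂ν = Z⁻¹ * ∫ U, G U * f U ∂μ := by
    intro G
    rw [hν, integral_smul_measure, integral_withDensity_eq_integral_toReal_smul hFdm
      (ae_of_all _ fun _ => ENNReal.ofReal_lt_top), ENNReal.toReal_inv, ENNReal.toReal_ofReal hZ0, smul_eq_mul]
    congr 1
    exact integral_congr_ae (ae_of_all _ fun U => by
      simp only [hFd, ENNReal.toReal_ofReal (hf0 U), smul_eq_mul, mul_comm])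
  have hLSν : ∀ a : ℝ, 0 ≤ a → a ≤ a₀ → ∀ X : Finset (Plaq P j),
      (∀ q ∈ X, ∃ c ∈ D, ∃ p' ∈ R c, q ∈ boxRegion (emb p'.src) ((P.d + 3) * P.L + 2)) →
      ∫ U, Real.exp (a * β * ∑ q ∈ X, (1 - reTr (GaugeField.plaqHol U q))) ∂ν ≤ Real.exp (C * a * X.card) := by
    intro a ha0 ha X hX
    rw [hνint]
    calc Z⁻¹ * ∫ U, Real.exp (a * β * ∑ q ∈ X, (1 - reTr (GaugeField.plaqHol U q))) * f U ∂μ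
        ≤ Z⁻¹ * (Real.exp (C * a * X.card) * Z) :=
          mul_le_mul_of_nonneg_left (hLS a ha0 ha X hX) (inv_nonneg.2 hZ0)
      _ = Real.exp (C * a * X.card) := by field_simp
  have hP := measureReal_largeFieldCells_avgFun_le_of_moments_hull (n := Fin N) hj hα hguard ν hβ hC D R hLSν hδ0 hδ ε m hm hdisj
  have hreal : ν.real S = Z⁻¹ * ∫ U in S, f U ∂μ := by
    rw [← integral_indicator_one hSm, hνint, ← integral_indicator hSm]
    congr 1
    refine integral_congr_ae (ae_of_all _ fun U => ?_)
    show S.indicator 1 U * f U = S.indicator f U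
    by_cases hU : U ∈ S
    · simp only [Set.indicator_of_mem hU, Pi.one_apply, one_mul]
    · simp only [Set.indicator_of_notMem hU, zero_mul]
  have hmain : Z⁻¹ * ∫ U in S, f U ∂μ ≤ r := by rw [← hreal]; exact hP
  calc ∫ U in S, f U ∂μ = Z * (Z⁻¹ * ∫ U in S, f U ∂μ) := by field_simp
    _ ≤ Z * r := mul_le_mul_of_nonneg_left hmain hZ0
    _ = r * Z := mul_comm _ _

end Record
section Subfamily

variable (F : T4Family) (N : ℕ) [NeZero N] (ν : Stage7Numerics) (M : ℕ) (p : B12.RunParams) (g : ℕ → ℝ)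

/-- ★★★ **FROM «LCS-k ON THE HULL», SUB-FAMILY** (module 23's `abs_integral_pinnedSubfamily_le_of_moments`, the moment hypothesis asked only for the
level-`k` plaquette sets inside the hull of the pinned cubes' regularity regions `⋃_{c∈D} R c`): for the old piece `f ≥ 0` at a performed step `k < K`,
`|∫ (Σ_{t∈E} ω s t (U,Ū))·f dU| ≤ (m·e^{C·A·M·M·δ − δβ·ε″²∕(2N)})^{#D}·∫ f dU`, modulo `IsZetaAbsLeOne`, `0 ≤ ζ` and the regularity letters.  What the
(A1c) instance owes at `k ≥ 1` for the pinned labels is the moment form of «LCS-k» ON THE HULL — nothing wider. [folklore] -/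
theorem abs_integral_pinnedSubfamily_le_of_moments_hull (k : ℕ) (hk : k < p.K) {α : ℝ} (hα : 0 < α)
    (hguard : (((((F.P p.K).d + 2) * (F.P p.K).L : ℕ) : ℝ) ^ 2 / 4) * Real.sqrt (2 * (Fintype.card (Fin N) : ℝ) * α) <
      deltaSU (Fin N))
    (A₁ : ℝ) {ζ : ZetaOfRecord F N ν M} (hζ : IsZetaAbsLeOne F N ν M ζ)
    (hζ0 : ∀ q g' k' (s : SeqOfRecord F ν M g' q.K k') Pl Ql RS U V', 0 ≤ ζ q g' k' s Pl Ql RS U V')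
    (s : SeqOfRecord F ν M g p.K k)
    {f : GaugeField (F.P p.K) k (SU N) → ℝ} (hfm : Measurable f) (hf0 : ∀ U, 0 ≤ f U)
    (hf : Integrable f (fieldMeasure (F.P p.K) k (SU N))) {β : ℝ} (hβ : 0 ≤ β) {C a₀ : ℝ} (hC : 0 ≤ C)
    (D : Finset (Iχ F ν p g k)) (R : Iχ F ν p g k → Finset (Plaq (F.P p.K) (k + 1)))
    (hLS : ∀ a : ℝ, 0 ≤ a → a ≤ a₀ → ∀ X : Finset (Plaq (F.P p.K) k),
      (∀ q ∈ X, ∃ c ∈ D, ∃ p' ∈ R c, q ∈ boxRegion (emb p'.src) (((F.P p.K).d + 3) * (F.P p.K).L + 2)) →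
      ∫ U, Real.exp (a * β * ∑ q ∈ X, (1 - reTr (GaugeField.plaqHol U q))) * f U ∂(fieldMeasure (F.P p.K) k (SU N)) ≤
        Real.exp (C * a * X.card) * ∫ U, f U ∂(fieldMeasure (F.P p.K) k (SU N)))
    {δ : ℝ} (hδ0 : 0 ≤ δ)
    (hδ : δ * ((2 * (Fintype.card (Fin N) : ℝ) * (((F.P p.K).L : ℝ) ^ 2 + 6 * ((((F.P p.K).d + 2) * (F.P p.K).L : ℕ) : ℝ) ^ 2) ^ 2 + 2 / α) *
      (((2 * (((F.P p.K).d + 3) * (F.P p.K).L + 2) + 1) ^ (F.P p.K).d * (F.P p.K).d ^ 2 : ℕ) : ℝ)) ≤ a₀)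
    (E : Finset (LbOfRecord F ν p g k)) (hE : ∀ t ∈ E, D ⊆ t.1)
    (m : ℕ) {ε'' : ℝ} (hε : 0 ≤ ε'')
    (hm : ∀ c ∈ D, (R c).card ≤ m) (hdisj : ∀ c₁ ∈ D, ∀ c₂ ∈ D, c₁ ≠ c₂ → Disjoint (R c₁) (R c₂))
    (hreg : ∀ c ∈ D, ∀ V' : GaugeField (F.P p.K) (k + 1) (SU N),
      (∀ p' ∈ R c, dist1 (GaugeField.plaqHol V' p') < ε'') → chiFactor F N ν p g k c V' = 1) :
    |∫ U, (∑ t ∈ E, ωOfRecord F N ν M p g k A₁ ζ s t U ((avOfRecord F N p.K k).avg U)) * f U ∂(fieldMeasure (F.P p.K) k (SU N))| ≤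
      ((m : ℝ) * Real.exp (C * ((2 * (Fintype.card (Fin N) : ℝ) *
            (((F.P p.K).L : ℝ) ^ 2 + 6 * ((((F.P p.K).d + 2) * (F.P p.K).L : ℕ) : ℝ) ^ 2) ^ 2 + 2 / α) *
          (((2 * (((F.P p.K).d + 3) * (F.P p.K).L + 2) + 1) ^ (F.P p.K).d * (F.P p.K).d ^ 2 : ℕ) : ℝ)) *
          (((2 * (((F.P p.K).d + 3) * (F.P p.K).L + 2) + 1) ^ (F.P p.K).d * (F.P p.K).d ^ 2 : ℕ) : ℝ) * δ -
            δ * β * (ε'' ^ 2 / (2 * (Fintype.card (Fin N) : ℝ))))) ^ D.card *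
        ∫ U, f U ∂(fieldMeasure (F.P p.K) k (SU N)) := by
  classical
  have hj : k + 1 ≤ (F.P p.K).m + (F.P p.K).K := by
    simp only [T4Family.P_m, T4Family.P_K]; omega
  have h1 := abs_integral_sum_sub_mul_le F N ν M p g k A₁ hζ hζ0 s D E hE R ε'' hreg hf0 hf
  set S : Set (GaugeField (F.P p.K) k (SU N)) :=
    {U | ∀ c ∈ D, ∃ p' ∈ R c, ε'' ≤ dist1 (GaugeField.plaqHol ((avOfRecord F N p.K k).avg U) p')} with hS
  set S' : Set (GaugeField (F.P p.K) k (SU N)) :=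
    {U | ∀ c ∈ D, ∃ p' ∈ R c, ε'' ^ 2 / (2 * (Fintype.card (Fin N) : ℝ)) ≤
      1 - reTr (GaugeField.plaqHol (BlockAveraging.avgFun (ExpMeanLog.expMeanLogSU (n := Fin N)) U) p')} with hS'
  have hsub : S ⊆ S' := by
    intro U hU c hc
    obtain ⟨p', hp', hle⟩ := hU c hc
    exact ⟨p', hp', sq_div_le_one_sub_reTr_of_le_dist1 _ hε hle⟩
  have h2 : ∫ U in S, f U ∂(fieldMeasure (F.P p.K) k (SU N)) ≤ ∫ U in S', f U ∂(fieldMeasure (F.P p.K) k (SU N)) :=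
    setIntegral_mono_set hf.integrableOn (ae_of_all _ hf0) (ae_of_all _ hsub)
  have h3 := setIntegral_forall_exists_le_of_moments_hull (N := N) hj hα hguard hfm hf0 hf hβ hC D R hLS hδ0 hδ
    (ε'' ^ 2 / (2 * (Fintype.card (Fin N) : ℝ))) m hm hdisj
  exact h1.trans (h2.trans h3)

end Subfamily

end Summit.QuantumFields.YangMills.BalabanUVNodes.N20LCSHullTransfer

end
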